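import Mathlib.Analysis.SpecialFunctions.Exp
import Mathlib.Analysis.SpecialFunctions.Pow.Real
import Mathlib.Analysis.Complex.ExponentialBounds
import Mathlib.Analysis.SpecificLimits.Basic
import HarnessLib

/-!
# Census closure, arithmetic core I: the barrier and the single-level estimates
# (stub C of the line `level-census-comparison`, crux `EnergyCurrentTails`, stmt-AtomisticToContinuum-9235)

Measure-free real analysis behind the registered stub `stub_censusClosure` (helper file of the
line lead's seat c2; registered main theorem `census_levelBand_le`, the band estimate in `∀`-form).
The comparison barrier of the line is `b(E) = β M e^{−αE} E^{−2}` with `E₀ = RΔ`, `α = L/E₀`,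
`β = m₂ e^{L} E₀` (so that `b(E₀) = M m₂/E₀`, the Chebyshev anchor); all functions enter through
defining hypotheses (`hb : ∀ E, b E = …`), nothing is defined.  An abstract census majorant
`nhi : ℝ → ℝ` is assumed to satisfy the a-priori bounds of the closure — Chebyshev
`nhi E' ≤ M m₂/E'`, and `nhi E' ≤ b E' + δ₀` on `[E₀, Etop]`, `nhi E' ≤ b E'` above `Etop` — and we
prove the three SINGLE-LEVEL estimates of the supersolution inequality at a level `E ≥ E₀`:
* band `nhi(E−Δ) ≤ (1 + 2(L+4)/R) b(E) + δ₀` (`census_band_le`; barrier regime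
  `b(E−Δ)/b(E) = e^{L/R}(E/(E−Δ))²`, boundary layer `E−Δ < E₀` by Chebyshev against the anchor);
* decay target `b(3E/2) ≤ b(E)/10` for `L ≥ 4` (`census_decay_le`);
* tail `∑_{k<K} √(2^{k+1}Y) nhi(2^kY) ≤ 4(βM e^{−αY} + δ₀ Etop²) √Y/Y²` for `Y ≥ E₀`
  (`census_tail_le`, the dyadic layer-cake majorant of the speed census; geometric sum).
The pair (merge/spallation) sums and the assembled supersolution inequality are in the sibling
files `…LevelCensusClosureMerge`, `…ClosureSpallation`, `…ClosureCore`.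

References: Gamba–Panferov–Villani 2009 (comparison principle for Maxwellian-weighted pointwise
bounds, ARMA 194) for the barrier idea; the estimates themselves are elementary.
-/

noncomputable section

open Real Finset

namespace Summit.AtomisticToContinuum.HydrodynamicLimit.Theorems.EnergyCurrentTailsLevelCensus

/-! ## The barrier `b(E) = β M e^{−αE}/E²` -/

section Barrier

variable {M m₂ L Δ E₀ α β : ℝ} {R : ℕ} {b : ℝ → ℝ}

/-- Ratio identity of the barrier: `b E' = b E · e^{α(E−E')} (E/E')²`. -/
theorem barrier_eq_mul (hb : ∀ E, b E = β * M * Real.exp (-(α * E)) / E ^ 2) {E E' : ℝ}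
    (hE : E ≠ 0) (hE' : E' ≠ 0) :
    b E' = b E * (Real.exp (α * (E - E')) * (E / E') ^ 2) := by
  rw [hb E, hb E']
  have h : Real.exp (-(α * E')) = Real.exp (-(α * E)) * Real.exp (α * (E - E')) := by
    rw [← Real.exp_add]; ring_nf
  rw [h]
  field_simp

/-- The barrier is positive at nonzero levels. -/
theorem barrier_pos (hb : ∀ E, b E = β * M * Real.exp (-(α * E)) / E ^ 2) (hβ : 0 < β)
    (hM : 0 < M) {E : ℝ} (hE : E ≠ 0) : 0 < b E := by
  rw [hb E]
  have : 0 < E ^ 2 := by positivity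
  positivity

/-- The barrier is antitone on `(0, ∞)` (for `α ≥ 0`). -/
theorem barrier_antitone (hb : ∀ E, b E = β * M * Real.exp (-(α * E)) / E ^ 2) (hβ : 0 < β)
    (hM : 0 < M) (hα : 0 ≤ α) {E E' : ℝ} (hE : 0 < E) (hEE' : E ≤ E') : b E' ≤ b E := by
  have hE' : 0 < E' := lt_of_lt_of_le hE hEE'
  rw [barrier_eq_mul hb hE.ne' hE'.ne']
  have hbE : 0 < b E := barrier_pos hb hβ hM hE.ne'
  have h1 : Real.exp (α * (E - E')) ≤ 1 := by
    rw [Real.exp_le_one_iff]; nlinarith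
  have h2 : (E / E') ^ 2 ≤ 1 := by
    have : E / E' ≤ 1 := by rw [div_le_one hE']; exact hEE'
    have h0 : 0 ≤ E / E' := by positivity
    nlinarith
  calc b E * (Real.exp (α * (E - E')) * (E / E') ^ 2) ≤ b E * (1 * 1) := by
        apply mul_le_mul_of_nonneg_left _ hbE.le
        exact mul_le_mul h1 h2 (by positivity) zero_le_one
    _ = b E := by ring

/-- The Chebyshev anchor: `b E₀ = M m₂/E₀` for `β = m₂ e^{L} E₀`, `α = L/E₀`. -/
theorem barrier_anchor (hb : ∀ E, b E = β * M * Real.exp (-(α * E)) / E ^ 2) (hE₀ : 0 < E₀)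
    (hα : α = L / E₀) (hβ : β = m₂ * Real.exp L * E₀) : b E₀ = M * m₂ / E₀ := by
  rw [hb E₀, hβ, hα]
  have h : Real.exp (-(L / E₀ * E₀)) = Real.exp (-L) := by
    congr 1; field_simp
  rw [h, Real.exp_neg]
  have h2 : Real.exp L ≠ 0 := (Real.exp_pos L).ne'
  field_simp

/-- Chebyshev in barrier units: `M m₂ / y = b E · e^{α(E−E₀)} (E/E₀)² (E₀/y)`. -/
theorem chebyshev_eq_barrier_mul (hb : ∀ E, b E = β * M * Real.exp (-(α * E)) / E ^ 2)
    (hE₀ : 0 < E₀) (hα : α = L / E₀) (hβ : β = m₂ * Real.exp L * E₀) {E y : ℝ} (hE : E ≠ 0)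
    (hy : y ≠ 0) :
    M * m₂ / y = b E * (Real.exp (α * (E - E₀)) * (E / E₀) ^ 2) * (E₀ / y) := by
  rw [← barrier_eq_mul hb hE hE₀.ne', barrier_anchor hb hE₀ hα hβ]
  field_simp

/-- Above `E₀` the barrier is at most `M` (given `m₂ ≤ E₀`). -/
theorem barrier_le_M (hb : ∀ E, b E = β * M * Real.exp (-(α * E)) / E ^ 2) (hM : 0 < M)
    (hm₂ : 0 < m₂) (hE₀ : m₂ ≤ E₀) (hα : α = L / E₀) (hβ : β = m₂ * Real.exp L * E₀) (hL : 0 ≤ L)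
    {E : ℝ} (hE : E₀ ≤ E) : b E ≤ M := by
  have hE₀pos : 0 < E₀ := lt_of_lt_of_le hm₂ hE₀
  have hβpos : 0 < β := by rw [hβ]; positivity
  have hαnn : 0 ≤ α := by rw [hα]; positivity
  calc b E ≤ b E₀ := barrier_antitone hb hβpos hM hαnn hE₀pos hE
    _ = M * m₂ / E₀ := barrier_anchor hb hE₀pos hα hβ
    _ ≤ M := by
        rw [div_le_iff₀ hE₀pos]
        nlinarith


/-- Product of two barriers in units of `b E`:
`b y · b w = b E · βM e^{α(E−y−w)} (E/(yw))²`. -/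
theorem barrier_mul_barrier (hb : ∀ E, b E = β * M * Real.exp (-(α * E)) / E ^ 2) {E y w : ℝ}
    (hE : E ≠ 0) (hy : y ≠ 0) (hw : w ≠ 0) :
    b y * b w = b E * (β * M * Real.exp (α * (E - y - w)) * (E / (y * w)) ^ 2) := by
  rw [hb E, hb y, hb w]
  have h : Real.exp (-(α * y)) * Real.exp (-(α * w))
      = Real.exp (-(α * E)) * Real.exp (α * (E - y - w)) := by
    rw [← Real.exp_add, ← Real.exp_add]; ring_nf
  field_simp
  linear_combination (β ^ 2 * M ^ 2) * h

/-- A barrier value in units of `b E`: if `E ≤ κ y` and `α(E − y) ≤ ℓ` then `b y ≤ e^{ℓ} κ² b E`. -/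
theorem barrier_le_of_ratio (hb : ∀ E, b E = β * M * Real.exp (-(α * E)) / E ^ 2) (hβ : 0 < β)
    (hM : 0 < M) {E y κ ℓ : ℝ} (hE : 0 < E) (hy : 0 < y) (hκ : E ≤ κ * y)
    (hℓ : α * (E - y) ≤ ℓ) : b y ≤ Real.exp ℓ * κ ^ 2 * b E := by
  rw [barrier_eq_mul hb hE.ne' hy.ne']
  have hbE : 0 < b E := barrier_pos hb hβ hM hE.ne'
  have h1 : Real.exp (α * (E - y)) ≤ Real.exp ℓ := Real.exp_le_exp.2 hℓ
  have h2 : (E / y) ^ 2 ≤ κ ^ 2 := by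
    have h0 : 0 ≤ E / y := by positivity
    have : E / y ≤ κ := by rw [div_le_iff₀ hy]; exact hκ
    exact pow_le_pow_left₀ h0 this 2
  calc b E * (Real.exp (α * (E - y)) * (E / y) ^ 2) ≤ b E * (Real.exp ℓ * κ ^ 2) := by
        apply mul_le_mul_of_nonneg_left _ hbE.le
        exact mul_le_mul h1 h2 (by positivity) (Real.exp_pos _).le
    _ = Real.exp ℓ * κ ^ 2 * b E := by ring

/-- A Chebyshev value in units of `b E`: if `α(E − E₀) ≤ ℓ`, `E ≤ κ₁ E₀`, `E₀ ≤ κ₂ y` then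
`M m₂ / y ≤ e^{ℓ} κ₁² κ₂ b E`. -/
theorem chebyshev_le_of_ratio (hb : ∀ E, b E = β * M * Real.exp (-(α * E)) / E ^ 2)
    (hM : 0 < M) (hm₂ : 0 < m₂) (hE₀ : 0 < E₀) (hα : α = L / E₀)
    (hβ : β = m₂ * Real.exp L * E₀) {E y κ₁ κ₂ ℓ : ℝ} (hE : 0 < E) (hy : 0 < y)
    (hℓ : α * (E - E₀) ≤ ℓ) (hκ₁ : E ≤ κ₁ * E₀) (hκ₂ : E₀ ≤ κ₂ * y) :
    M * m₂ / y ≤ Real.exp ℓ * κ₁ ^ 2 * κ₂ * b E := by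
  rw [chebyshev_eq_barrier_mul hb hE₀ hα hβ hE.ne' hy.ne']
  have hβpos : 0 < β := by rw [hβ]; positivity
  have hbE : 0 < b E := barrier_pos hb hβpos hM hE.ne'
  have h1 : Real.exp (α * (E - E₀)) ≤ Real.exp ℓ := Real.exp_le_exp.2 hℓ
  have h2 : (E / E₀) ^ 2 ≤ κ₁ ^ 2 := by
    have h0 : 0 ≤ E / E₀ := by positivity
    have : E / E₀ ≤ κ₁ := by rw [div_le_iff₀ hE₀]; exact hκ₁
    exact pow_le_pow_left₀ h0 this 2
  have h3 : E₀ / y ≤ κ₂ := by rw [div_le_iff₀ hy]; exact hκ₂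
  have h3' : 0 ≤ E₀ / y := by positivity
  calc b E * (Real.exp (α * (E - E₀)) * (E / E₀) ^ 2) * (E₀ / y)
      ≤ b E * (Real.exp ℓ * κ₁ ^ 2) * κ₂ := by
        apply mul_le_mul _ h3 h3' (by positivity)
        apply mul_le_mul_of_nonneg_left _ hbE.le
        exact mul_le_mul h1 h2 (by positivity) (Real.exp_pos _).le
    _ = Real.exp ℓ * κ₁ ^ 2 * κ₂ * b E := by ring

/-- Products of two census values, each within `δ` of a bound `≤ M`:
`p q ≤ X Y + 3 M δ`. -/
theorem mul_le_mul_add_three {p q X Y δ M : ℝ} (hp : 0 ≤ p) (hq : 0 ≤ q) (hpX : p ≤ X + δ)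
    (hqY : q ≤ Y + δ) (hXM : X ≤ M) (hYM : Y ≤ M) (hδ : 0 ≤ δ) (hδM : δ ≤ M) :
    p * q ≤ X * Y + 3 * M * δ := by
  have h1 : p * q ≤ (X + δ) * (Y + δ) := mul_le_mul hpX hqY hq (by linarith)
  have h2 : δ * (X + Y + δ) ≤ δ * (3 * M) := mul_le_mul_of_nonneg_left (by linarith) hδ
  nlinarith

end Barrier

/-! ## Single-level estimates: band, decay, tail -/

section Levels

variable {M m₂ L Δ E₀ α β δ₀ Etop : ℝ} {R : ℕ} {b nhi : ℝ → ℝ}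

/-- The band ratio: for `R ≥ 8`, `8L ≤ R`,
`e^{L/R} ((R+1)/R)² (R/(R−1)) ≤ 1 + 2(L+4)/R`. -/
theorem band_ratio_le (hL : 0 ≤ L) (hR8 : 8 ≤ (R : ℝ)) (hRL : 8 * L ≤ R) :
    Real.exp (L / R) * (((R : ℝ) + 1) / R) ^ 2 * ((R : ℝ) / (R - 1)) ≤ 1 + 2 * (L + 4) / R := by
  have hR0 : 0 < (R : ℝ) := by linarith
  set t : ℝ := 1 / R with ht
  have ht0 : 0 < t := by positivity
  have ht8 : t ≤ 1 / 8 := by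
    rw [ht, div_le_div_iff₀ hR0 (by norm_num)]; linarith
  have hLt : L / R = L * t := by rw [ht]; field_simp
  have hLt4 : L * t ≤ 1 / 4 := by
    rw [← hLt, div_le_iff₀ hR0]; linarith
  have h1 : Real.exp (L / R) ≤ 1 + 2 * (L * t) := by
    rw [hLt]
    have hLt0 : 0 ≤ L * t := by positivity
    have h := Real.abs_exp_sub_one_le (x := L * t) (by rw [abs_of_nonneg hLt0]; linarith)
    rw [abs_of_nonneg hLt0] at h
    linarith [le_abs_self (Real.exp (L * t) - 1)]
  have h2 : (((R : ℝ) + 1) / R) ^ 2 = (1 + t) ^ 2 := by rw [ht]; field_simp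
  have h3 : (R : ℝ) / (R - 1) ≤ 1 + 2 * t := by
    rw [ht, div_le_iff₀ (by linarith)]
    field_simp
    nlinarith
  have h4 : 1 + 2 * (L + 4) / R = 1 + 2 * (L * t) + 8 * t := by rw [ht]; field_simp; ring
  rw [h2, h4]
  have hA : 0 ≤ 1 + 2 * (L * t) := by positivity
  calc Real.exp (L / R) * (1 + t) ^ 2 * ((R : ℝ) / (R - 1))
      ≤ (1 + 2 * (L * t)) * (1 + t) ^ 2 * (1 + 2 * t) := by
        apply mul_le_mul _ h3 (div_pos hR0 (by linarith)).le (by positivity)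
        exact mul_le_mul_of_nonneg_right h1 (by positivity)
    _ ≤ 1 + 2 * (L * t) + 8 * t := by
        have hLt0 : 0 ≤ L * t := by positivity
        nlinarith [mul_le_mul_of_nonneg_left ht8 hLt0, mul_le_mul_of_nonneg_left ht8 ht0.le,
          mul_le_mul_of_nonneg_left hLt4 ht0.le, sq_nonneg t, mul_nonneg hLt0 (sq_nonneg t),
          mul_nonneg ht0.le (sq_nonneg t)]

/-- **The band** `(E−Δ, E]`: for `E ≥ E₀`, `nhi(E−Δ) ≤ (1 + 2(L+4)/R) b(E) + δ₀` (barrier regime: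
`b(E−Δ)/b(E) = e^{L/R}(E/(E−Δ))²`; boundary layer `E − Δ < E₀`: Chebyshev against the anchor). -/
theorem census_band_le (hb : ∀ E, b E = β * M * Real.exp (-(α * E)) / E ^ 2) (hM : 0 < M)
    (hm₂ : 0 < m₂) (hL : 0 ≤ L) (hR8 : 8 ≤ (R : ℝ)) (hRL : 8 * L ≤ R) (hΔ : m₂ ≤ Δ)
    (hE₀ : E₀ = R * Δ) (hα : α = L / E₀) (hβ : β = m₂ * Real.exp L * E₀)
    (h2 : ∀ E', 0 < E' → nhi E' ≤ M * m₂ / E') (h4 : ∀ E', E₀ ≤ E' → nhi E' ≤ b E' + δ₀)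
    (hδ₀ : 0 ≤ δ₀) {E : ℝ} (hE : E₀ ≤ E) :
    nhi (E - Δ) ≤ (1 + 2 * (L + 4) / R) * b E + δ₀ := by
  have hΔ0 : 0 < Δ := lt_of_lt_of_le hm₂ hΔ
  have hR0 : 0 < (R : ℝ) := by linarith
  have hE₀pos : 0 < E₀ := by rw [hE₀]; positivity
  have hEpos : 0 < E := by linarith
  have hE₀Δ : 8 * Δ ≤ E₀ := by rw [hE₀]; exact mul_le_mul_of_nonneg_right hR8 hΔ0.le
  have hEΔ : 0 < E - Δ := by linarith
  have hβpos : 0 < β := by rw [hβ]; positivity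
  have hαnn : 0 ≤ α := by rw [hα]; positivity
  have hbE : 0 < b E := barrier_pos hb hβpos hM hEpos.ne'
  have hαΔ : α * Δ = L / R := by rw [hα, hE₀]; field_simp
  have hρ := band_ratio_le hL hR8 hRL
  set ρ : ℝ := Real.exp (L / R) * (((R : ℝ) + 1) / R) ^ 2 * ((R : ℝ) / (R - 1)) with hρdef
  -- `E ≤ (R/(R-1)) (E - Δ)` and friends
  have hκ : E ≤ (R : ℝ) / (R - 1) * (E - Δ) := by
    rw [div_mul_eq_mul_div, le_div_iff₀ (by linarith)]
    rw [hE₀] at hE; nlinarith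
  have hRR : ((R : ℝ) / (R - 1)) ^ 2 ≤ (((R : ℝ) + 1) / R) ^ 2 * ((R : ℝ) / (R - 1)) := by
    have hq : 0 < (R : ℝ) / (R - 1) := by apply div_pos hR0; linarith
    rw [sq, mul_le_mul_iff_left₀ hq, div_le_iff₀ (by linarith), div_pow,
      div_mul_eq_mul_div, le_div_iff₀ (by positivity)]
    nlinarith
  suffices hX : ∃ X : ℝ, nhi (E - Δ) ≤ X + δ₀ ∧ X ≤ ρ * b E by
    obtain ⟨X, hX, hXρ⟩ := hX
    have := mul_le_mul_of_nonneg_right hρ hbE.le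
    linarith
  by_cases hc : E₀ ≤ E - Δ
  · refine ⟨b (E - Δ), h4 _ hc, ?_⟩
    have h := barrier_le_of_ratio hb hβpos hM hEpos hEΔ (κ := (R : ℝ) / (R - 1)) (ℓ := L / R) hκ
      (by rw [← hαΔ]; apply le_of_eq; ring)
    have hρ' : Real.exp (L / R) * ((R : ℝ) / (R - 1)) ^ 2 ≤ ρ := by
      rw [hρdef, mul_assoc]
      exact mul_le_mul_of_nonneg_left hRR (Real.exp_pos _).le
    exact h.trans (mul_le_mul_of_nonneg_right hρ' hbE.le)
  · push Not at hc
    refine ⟨M * m₂ / (E - Δ), by linarith [h2 _ hEΔ], ?_⟩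
    have h := chebyshev_le_of_ratio hb hM hm₂ hE₀pos hα hβ hEpos hEΔ (κ₁ := ((R : ℝ) + 1) / R)
      (κ₂ := (R : ℝ) / (R - 1)) (ℓ := L / R) ?_ ?_ ?_
    · simpa [hρdef, mul_assoc] using h
    · rw [← hαΔ]; exact mul_le_mul_of_nonneg_left (by linarith) hαnn
    · rw [hE₀]; field_simp; rw [hE₀] at hc; nlinarith
    · rw [div_mul_eq_mul_div, le_div_iff₀ (by linarith)]
      rw [hE₀] at hE ⊢; nlinarith

/-- **The decay target**: for `E ≥ E₀` (`L ≥ 4`), `b(3E/2) ≤ b(E)/10`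
(`b(3E/2)/b(E) = (4/9) e^{−αE/2} ≤ (4/9) e^{−2}`). -/
theorem census_decay_le (hb : ∀ E, b E = β * M * Real.exp (-(α * E)) / E ^ 2) (hM : 0 < M)
    (hβ : 0 < β) (hE₀ : 0 < E₀) (hαE₀ : α * E₀ = L) (hL : 4 ≤ L) {E : ℝ} (hE : E₀ ≤ E) :
    b (3 / 2 * E) ≤ b E / 10 := by
  have hEpos : 0 < E := by linarith
  have hbE : 0 < b E := barrier_pos hb hβ hM hEpos.ne'
  have hαnn : 0 ≤ α := by
    by_contra h; push Not at h
    have : α * E₀ < 0 := mul_neg_of_neg_of_pos h hE₀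
    linarith
  rw [barrier_eq_mul hb hEpos.ne' (show 3 / 2 * E ≠ 0 by positivity)]
  have h1 : (E / (3 / 2 * E)) ^ 2 = 4 / 9 := by field_simp; norm_num
  have h2 : Real.exp (α * (E - 3 / 2 * E)) ≤ (Real.exp 1 * Real.exp 1)⁻¹ := by
    rw [← Real.exp_add, ← Real.exp_neg, Real.exp_le_exp]
    have : α * E₀ ≤ α * E := mul_le_mul_of_nonneg_left hE hαnn
    nlinarith
  have h3 : (Real.exp 1 * Real.exp 1)⁻¹ ≤ 9 / 40 := by
    have he := Real.exp_one_gt_d9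
    rw [inv_le_comm₀ (by positivity) (by norm_num)]
    nlinarith
  rw [h1]
  calc b E * (Real.exp (α * (E - 3 / 2 * E)) * (4 / 9)) ≤ b E * (9 / 40 * (4 / 9)) := by
        apply mul_le_mul_of_nonneg_left _ hbE.le
        exact mul_le_mul_of_nonneg_right (h2.trans h3) (by norm_num)
    _ = b E / 10 := by ring

/-- **The tail** (dyadic layer cake of the speed census above `Y ≥ E₀`): for every `K`,
`∑_{k<K} √(2^{k+1}Y) nhi(2^kY) ≤ 4 (βM e^{−αY} + δ₀ Etop²) √Y / Y²`
(`nhi ≤ b + δ₀ 𝟙{· ≤ Etop}` above `E₀`, `b(2^kY) ≤ βM e^{−αY}/(4^k Y²)`, `∑ 2^{−k} ≤ 2`). -/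
theorem census_tail_le (hb : ∀ E, b E = β * M * Real.exp (-(α * E)) / E ^ 2) (hM : 0 < M)
    (hβ : 0 < β) (hα : 0 ≤ α) (hE₀ : 0 < E₀)
    (h4 : ∀ E', E₀ ≤ E' → E' ≤ Etop → nhi E' ≤ b E' + δ₀) (h4' : ∀ E', Etop < E' → nhi E' ≤ b E')
    (hδ₀ : 0 ≤ δ₀) {Y : ℝ} (hY : E₀ ≤ Y) (K : ℕ) :
    ∑ k ∈ Finset.range K, Real.sqrt (2 ^ (k + 1) * Y) * nhi (2 ^ k * Y)
      ≤ 4 * (β * M * Real.exp (-(α * Y)) + δ₀ * Etop ^ 2) * Real.sqrt Y / Y ^ 2 := by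
  have hYpos : 0 < Y := lt_of_lt_of_le hE₀ hY
  set Γ : ℝ := β * M * Real.exp (-(α * Y)) + δ₀ * Etop ^ 2 with hΓ
  have hΓ0 : 0 ≤ Γ := by positivity
  -- per-term bound
  have hterm : ∀ k : ℕ, Real.sqrt (2 ^ (k + 1) * Y) * nhi (2 ^ k * Y)
      ≤ 2 * Γ * Real.sqrt Y / Y ^ 2 * (1 / 2) ^ k := by
    intro k
    have h2k : (1 : ℝ) ≤ 2 ^ k := one_le_pow₀ (by norm_num)
    have hlev : Y ≤ 2 ^ k * Y := le_mul_of_one_le_left hYpos.le h2k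
    have hlevpos : 0 < 2 ^ k * Y := by positivity
    -- the census at the dyadic level
    have hb2 : b (2 ^ k * Y) ≤ β * M * Real.exp (-(α * Y)) / (4 ^ k * Y ^ 2) := by
      rw [hb, mul_pow, ← pow_mul, show (2 : ℝ) ^ (k * 2) = 4 ^ k by
        rw [mul_comm, pow_mul]; norm_num]
      apply div_le_div_of_nonneg_right _ (by positivity)
      apply mul_le_mul_of_nonneg_left _ (by positivity)
      rw [Real.exp_le_exp]
      nlinarith [mul_le_mul_of_nonneg_left hlev hα]
    have hn : nhi (2 ^ k * Y) ≤ Γ / (4 ^ k * Y ^ 2) := by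
      have hsq : (2 ^ k * Y) ^ 2 = 4 ^ k * Y ^ 2 := by
        rw [mul_pow, ← pow_mul, show (2 : ℝ) ^ (k * 2) = 4 ^ k by rw [mul_comm, pow_mul]; norm_num]
      rw [hΓ, add_div]
      by_cases htop : 2 ^ k * Y ≤ Etop
      · have h := h4 _ (hY.trans hlev) htop
        have hδ : δ₀ ≤ δ₀ * Etop ^ 2 / (4 ^ k * Y ^ 2) := by
          rw [le_div_iff₀ (by positivity), ← hsq]
          apply mul_le_mul_of_nonneg_left _ hδ₀
          exact pow_le_pow_left₀ hlevpos.le htop 2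
        linarith
      · push Not at htop
        have h := h4' _ htop
        have hδ : 0 ≤ δ₀ * Etop ^ 2 / (4 ^ k * Y ^ 2) := by positivity
        linarith
    have hsqrt : Real.sqrt (2 ^ (k + 1) * Y) ≤ 2 ^ (k + 1) * Real.sqrt Y := by
      rw [Real.sqrt_mul' _ hYpos.le]
      apply mul_le_mul_of_nonneg_right _ (Real.sqrt_nonneg _)
      rw [Real.sqrt_le_left (by positivity)]
      nlinarith [one_le_pow₀ (show (1 : ℝ) ≤ 2 by norm_num) (n := k + 1)]
    have hn0 : 0 ≤ nhi (2 ^ k * Y) ∨ nhi (2 ^ k * Y) < 0 := le_or_gt _ _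
    rcases hn0 with hn0 | hn0
    · calc Real.sqrt (2 ^ (k + 1) * Y) * nhi (2 ^ k * Y)
          ≤ (2 ^ (k + 1) * Real.sqrt Y) * (Γ / (4 ^ k * Y ^ 2)) :=
            mul_le_mul hsqrt hn hn0 (by positivity)
        _ = 2 * Γ * Real.sqrt Y / Y ^ 2 * (2 ^ k / 4 ^ k) := by
            rw [pow_succ]; field_simp
        _ = 2 * Γ * Real.sqrt Y / Y ^ 2 * (1 / 2) ^ k := by
            congr 1
            rw [div_pow, one_pow, show (4 : ℝ) ^ k = 2 ^ k * 2 ^ k by rw [← mul_pow]; norm_num]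
            field_simp
    · calc Real.sqrt (2 ^ (k + 1) * Y) * nhi (2 ^ k * Y) ≤ 0 :=
            mul_nonpos_of_nonneg_of_nonpos (Real.sqrt_nonneg _) hn0.le
        _ ≤ 2 * Γ * Real.sqrt Y / Y ^ 2 * (1 / 2) ^ k := by positivity
  calc ∑ k ∈ Finset.range K, Real.sqrt (2 ^ (k + 1) * Y) * nhi (2 ^ k * Y)
      ≤ ∑ k ∈ Finset.range K, 2 * Γ * Real.sqrt Y / Y ^ 2 * (1 / 2) ^ k :=
        Finset.sum_le_sum fun k _ => hterm k
    _ = 2 * Γ * Real.sqrt Y / Y ^ 2 * ∑ k ∈ Finset.range K, (1 / 2 : ℝ) ^ k := by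
        rw [Finset.mul_sum]
    _ ≤ 2 * Γ * Real.sqrt Y / Y ^ 2 * 2 :=
        mul_le_mul_of_nonneg_left (sum_geometric_two_le K) (by positivity)
    _ = 4 * Γ * Real.sqrt Y / Y ^ 2 := by ring

end Levels

/-- **Registered main theorem of this file (band estimate, `∀`-form).**  For `E ≥ E₀ = RΔ`
(`R ≥ 8`, `8L ≤ R`, `m₂ ≤ Δ`): `nhi(E − Δ) ≤ (1 + 2(L+4)/R) b(E) + δ₀`. -/
theorem census_levelBand_le :
    ∀ (M m₂ L Δ E₀ α β δ₀ : ℝ) (R : ℕ) (b nhi : ℝ → ℝ),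
      (∀ E, b E = β * M * Real.exp (-(α * E)) / E ^ 2) → 0 < M → 0 < m₂ → 0 ≤ L →
      8 ≤ (R : ℝ) → 8 * L ≤ R → m₂ ≤ Δ → E₀ = R * Δ → α = L / E₀ →
      β = m₂ * Real.exp L * E₀ → (∀ E', 0 < E' → nhi E' ≤ M * m₂ / E') →
      (∀ E', E₀ ≤ E' → nhi E' ≤ b E' + δ₀) → 0 ≤ δ₀ →
      ∀ E : ℝ, E₀ ≤ E → nhi (E - Δ) ≤ (1 + 2 * (L + 4) / R) * b E + δ₀ :=
  fun _ _ _ _ _ _ _ _ _ _ _ hb hM hm₂ hL hR8 hRL hΔ hE₀ hα hβ h2 h4 hδ₀ _ hE =>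
    census_band_le hb hM hm₂ hL hR8 hRL hΔ hE₀ hα hβ h2 h4 hδ₀ hE

end Summit.AtomisticToContinuum.HydrodynamicLimit.Theorems.EnergyCurrentTailsLevelCensus

end
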